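import Summits.QuantumFields.YangMills.Theorems.BalabanUVNodesN11NoExpansionStepReductionTClauseUnivECoPH
import Summits.QuantumFields.YangMills.Theorems.BalabanUVNodesN11FluctTruncationGraph
import Literature.MathematicalPhysics.QuantumFieldTheory.Balaban1983to89.B14NodeKnitRecord13RCoPH
import Literature.MathematicalPhysics.QuantumFieldTheory.Balaban1983to89.Node00.Record13CoreAtTheta13LiveOfRecord

/-!
# DAG node N11 — THE THEOREM OF p. 245 (N11's (S1ᵀ) slot `∀ k < K, SLaw_k → TLaw_k`), THEOREM 1 OF [III] AT ALL LEVELS AND ALL HISTORIES, AND THE NODE SENTENCES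
# `densitiesDescribed` ∕ `Dag.B14_main` AT A GENERIC v1.7 PARAMETER `θ` — MODULO EXACTLY THE TWO NAMED PER-LEVEL DELIVERABLES: [III] §3's supply `Sect3SupplyAt θ p k`
# (the expansion sequences) and the no-expansion 𝐓-step `NoExpansionTStepAt θ p k` (dag-n11-d's lane)

Cell `pub-ymgap`, YM-PLAN Track A (HUMAN RULING D-0062), seat `pub-ymgap-dag-n11-e` (g14; R134 fan-out row N11∕s3 «`ThmP245Printed` :375 via `rOperation` from N13's `ROpLeaf`»),
route `BalabanUVNodes` rev 25 (v1.7 `CoPH` key), item K1⁷ `StabilityBAtRecordR13SepCoPH` = stmt-QuantumFields-20542 (helper lane, count-neutral).  [III] = [Balaban1988Convergent],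
[IV] = [Balaban1989LargeFieldI].  Over this seat's `…StepReductionTClauseUnivECoPH` (g14), `…Sect3SupplyDefs` (g14), `…B16RLeafRecord13LiveCoPH` (p540794), `…B14NodeKnitRecord13RCoPH`
(p543669), `Node00.Record13CoreAtTheta13LiveOfRecord` (p562464), dag-n11-d's `…N11RePinnedParamDefs` (p552185), `…N11FluctTruncationGraph` (INTENT-6) and the diagonal files their
`…GeneralStepRePinnedIntegrable` (p569094) §2 reads (`…CoPHDoor`, `…DiagonalOldBranchMeasurable`, `…AllLargeCoP`, `…DiagonalBranchIntegrable`, `…GeneralStepRePinned`, `…RePinnedOldBranchMeasurable`).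

WHY THIS FILE.  This seat's R134 row is N11's Theorem of p. 245 — «if `ρ_k` satisfies the assumptions described in Sect. 2, then `𝐓ρ_k` satisfies the corresponding
assumptions» — which at the Stage-13 record IS the (S1ᵀ) slot `∀ k < K, SLaw₁₃CoPH θ p k → TLaw₁₃CoPH θ p k` (`B14NodeKnitRecord13RCoPH.thmP245PrintedI_at_record₁₃CoPH_iff_laws`),
and N11's node sentence `densitiesDescribed` at a world bound to the record IS `∀ k ≤ K, SLaw₁₃CoPH θ p k` (`…LiveCoPH.densitiesDescribed_leavesP_iff_sLaw₁₃CoPH_all_datum`).  The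
inductive step has two halves: at the NO-EXPANSION sequences the 𝐓-image clause for the old terms (dag-n11-d's lane; in the tree at `rePinH θ` modulo the old-branch
integrability of a `k`-local witness, `…N11FluctTruncationGraph.exists_local_witness_clause_succ_rePinH_of_sLaw₁₃CoPH_of_graph`), at the EXPANSION sequences [III] §3 proper.
`…Sect3SupplyDefs` NAMES both as per-level predicates — `NoExpansionTStepAt θ p k`, `Sect3SupplyAt θ p k` — and `…StepReductionTClauseUnivECoPH` turns them into `TLaw_k` (the
new-𝐄 clauses being read off the supply).  This file CLOSES THE LOOP over the levels, GENERIC in `θ`: keyed on def-T's `SLaw₁₃CoPH` itself it delivers the (S1ᵀ) slot, Theorem 1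
at all levels by induction from def-T's `sLaw₁₃CoPH_zero` through this seat's live-line 𝐑-step, and the node sentences through the knit dictionaries — MODULO EXACTLY
`∀ k < K, NoExpansionTStepAt θ p k ∧ Sect3SupplyAt θ p k`.  HENCE:
§1 `tLaw₁₃CoPH_of_sLaw₁₃CoPH_of_tStep_of_supply` (one level) · §2 ★★★ `thmP245Laws_of_tStep_of_supply` (the (S1ᵀ) slot) · ★★★ `sLaw₁₃CoPH_all_of_tStep_of_supply_of_liveSel`
(THEOREM 1: `∀ k ≤ K, SLaw₁₃CoPH θ p k`, live-selector line) · §3 ★★★ `thmP245PrintedI_of_tStep_of_supply` ([III]'s OWN slot name `B14.ThmP245PrintedI` along any agreeing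
`T`-family — this seat's R134 row in its honest final form) · `densitiesDescribed_of_tStep_of_supply_of_liveSel` · `b14_main_of_tStep_of_supply_of_liveSel` (N11's node
`Dag.B14_main` at a world bound to the CoPH datum of `θ`) · §4 at `rePinH θ`: `noExpansionTStepAt_rePinH_of_integrable_row` (dag-n11-d's graph-edition witness-first face ⇒
`NoExpansionTStepAt (rePinH θ) p k` GIVEN the ONE old-branch integrability row for `k`-local law-abiding witnesses — today's residue of their lane, displayed) ·
A6 `sect3SupplyAt_of_forall_Omega_empty` (at a level where no sequence of length `k+1` expands the supply IS inhabited — the witness truncated above `k`; so the predicate is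
consistent and its whole content sits at the expansion sequences) · §3 also `thm1Printed_datumOfRecord₁₃CoPH_of_tStep_of_supply_of_liveSel` (`B16.Thm1Printed` at the CoPH
datum of θ, the route's (B)-face first conjunct, along the windowed runs) · §5 at the H-extensions of the WITNESS OF RECORD `theta13LiveOfRecord F N` (𝐑-side CLOSED,
`…LiveCoPH.laws₁₃CoPH_theta13LiveOfRecord`; `M = 1`, `0 ≤ E₀, B₀` the family's numerals): ★★★ `sLaw₁₃CoPH_all_theta13LiveOfRecordH_of_tStep_of_supply` · ★★★
`thm1Printed_datumOfRecord₁₃CoPH_theta13LiveOfRecordH_of_tStep_of_supply` — from the two per-level deliverables and NOTHING ELSE · §6 at the re-pinned door of K0a's cured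
family ∕ of the witness of record: `tClause_succ_rePinH_doorCured_of_allLarge_of_clause` (dag-n11-d p569094 §2 with the witness exposed) · ★★
`noExpansionTStepAt_rePinH_doorCured_zero` (a no-expansion history of LENGTH 1 IS the all-large one: the no-expansion 𝐓-step AT LEVEL 0 is a THEOREM there) · ★★
`sLaw₁₃CoPH_one_rePinH_doorCured_of_sect3Supply_zero_of_liveSel` · ★★★ `noExpansionTStepAt_rePinH_doorCured_theta13LiveOfRecord_zero` (`0 < K` only) · ★★★
`sLaw₁₃CoPH_one_rePinH_doorCured_theta13LiveOfRecord_of_sect3Supply_zero` (`ρ₁`'s §2 form at the re-pinned door of the cured witness of record, EVERY history of length 1,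
from `0 < K` and [III] §3's LEVEL-0 supply — [I] Thm 1 + [II] at `Ω₁ ≠ ∅` — and NOTHING ELSE).

HONEST FRAMING.  Count-neutral kernel bookkeeping: `Sect3SupplyAt` ([III] Sect. 1 ∕ §3 ∕ Thm 2 proper at `Ω_{k+1} ≠ ∅`) and `NoExpansionTStepAt` are DISPLAYED, per level, NOT
discharged; the zero branches of the §2 dichotomy are not excluded; nothing of Bałaban asserted; N11 NOT discharged; K1⁷ NOT closed; counts unmoved (typed 28∕28 · discharged
5∕27).  One finite `𝕋⁴_{L^K}` programme at fixed `ε = L^{−K}`; NOT ℝ⁴, NOT OS, NOT a mass gap, NOT Clay.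
Sources: [III] Theorem p.245, p.244, Thm 1 p.262, §2 p.262, (2.17)–(2.18) p.257, (2.20)–(2.31) pp.258–260, (2.40)–(2.42) p.261, (3.1) p.264, (3.24)–(3.25) p.270, p.279;
[IV] (0.2)–(0.4) p.176, p.177 (i)–(ii); [Balaban1987RG1] (0.20) p.256.
-/

noncomputable section

open MeasureTheory
open scoped BigOperators Matrix.Norms.L2Operator

namespace Summit.QuantumFields.YangMills.Theorems.BalabanUVNodesN11ThmP245OfSect3SupplyCoPH

open Literature.MathematicalPhysics.QuantumFieldTheory.Balaban1983to89 T4Continuum Node00 Node00.Tk DagBinding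
open Literature.MathematicalPhysics.QuantumFieldTheory.Balaban1983to89.B16RLeafRecord13LiveCoPH (sLaw₁₃CoPH_succ_of_tLaw₁₃CoPH_of_liveSel_of_rstep sLaw₁₃CoPH_all_of_laws
  densitiesDescribed_at_record₁₃CoPH_of_laws b14_main_at_record₁₃CoPH_of_rOpLeaf rOpLeaf_VOfRecord₁₃CoPH_of_liveSel_of_rstep laws₁₃CoPH_theta13LiveOfRecord)
open Literature.MathematicalPhysics.QuantumFieldTheory.Balaban1983to89.B16RLeafRecord13AtLive (B0_nonneg_theta13LiveOfFamily E0_nonneg_theta13LiveOfFamily)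
open Literature.MathematicalPhysics.QuantumFieldTheory.Balaban1983to89.B14NodeKnitRecord13RCoPH (thmP245PrintedI_at_record₁₃CoPH_iff_laws
  thm1Printed_datumOfRecord₁₃CoPH_theta13LiveOfRecord_of_thmP245I)
open BalabanUVNodesN11NoExpansionStepReductionTClauseUnivECoPH (tLaw₁₃CoPH_of_formAtZS_of_newTerms_of_tClause_of_expansion)
open BalabanUVNodesN11Sect3SupplyDefs
open BalabanUVNodesN11RePinnedParamDefs (rePinH provisos₁₃CoPH_rePinH)
open BalabanUVNodesN11NoExpansionGeneralStepRePinnedIntegrable (clause_succ_rePinH_of_Omega_empty_of_oldBranch_of_clause_of_integrable)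
open BalabanUVNodesN11NoExpansionGeneralStepCoPHDoor (hA_of_allLarge)
open BalabanUVNodesN11DiagonalOldBranchMeasurable (measurable_sect2Operand_CoP_of_allLarge)
open BalabanUVNodesN11NoExpansionAllLargeCoP (init_allLarge admSOfRecord_init_eq_of_allLarge)
open BalabanUVNodesN11DiagonalBranchIntegrable (integrable_tkBranch_door_of_allLarge)
open BalabanUVNodesN11NoExpansionGeneralStepRePinned (WtOfRecord₁₃H_rePinH_door_seqAllLarge)
open BalabanUVNodesN11RePinnedOldBranchMeasurable (hmB_rePinH_of_measurable_operand)
open BalabanUVNodesN11FluctTruncationDefs (IsFluctLocal)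
open BalabanUVNodesN11FluctTruncationGraph (exists_local_witness_clause_succ_rePinH_of_sLaw₁₃CoPH_of_graph)

variable {F : T4Family} {N : ℕ} [NeZero N]
variable (θ : Stage13HParams F N) (p : B12.RunParams)

/-! ## §1. One level: `TLaw₁₃CoPH θ p k` from `SLaw₁₃CoPH θ p k` and the two deliverables -/

section OneLevel

/-- **ONE LEVEL OF (S1ᵀ)**, generic `θ`: from `SLaw₁₃CoPH θ p k`, the no-expansion 𝐓-step at level `k` (`NoExpansionTStepAt θ p k`: SOME exposed witness `(t, E_k)` of the §2
form of `ρ_k` carries the 𝐓-image clause at every no-expansion sequence) and [III] §3's supply at level `k` FOR THAT WITNESS (`Sect3SupplyAt θ p k` quantifies over every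
exposed witness) — `TLaw₁₃CoPH θ p k` by `…StepReductionTClauseUnivECoPH`.  Only `1 ≤ M`, `0 ≤ B₀, E₀` besides.
[cite: Balaban1988Convergent, Theorem p.245, Thm 1 p.262, §2 p.262, (3.24)–(3.25) p.270, (2.18) p.257, (2.20)–(2.31) pp.258–260, p.279] -/
theorem tLaw₁₃CoPH_of_sLaw₁₃CoPH_of_tStep_of_supply {k : ℕ} (hM : 1 ≤ θ.τ9.M) (hB₀ : 0 ≤ θ.s2.lf.B₀) (hE₀ : 0 ≤ θ.s2.lf.E₀)
    (hS : SLaw₁₃CoPH F N θ p k) (hT : NoExpansionTStepAt θ p k) (hsup : Sect3SupplyAt θ p k) : TLaw₁₃CoPH F N θ p k := by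
  obtain ⟨t, Ek, hS', hTcl⟩ := hT hS
  obtain ⟨tT, EkT, huT, hbk, hexp⟩ := hsup t Ek hS'
  exact tLaw₁₃CoPH_of_formAtZS_of_newTerms_of_tClause_of_expansion θ p hM hB₀ hE₀ t Ek hS' tT EkT huT
    (fun s hΩ => ⟨(hbk s hΩ).1, (hbk s hΩ).2.1, (hbk s hΩ).2.2.1⟩) (fun s hΩ => (hbk s hΩ).2.2.2.1) (fun s hΩ => (hbk s hΩ).2.2.2.2.1)
    (fun s hΩ => (hbk s hΩ).2.2.2.2.2) hTcl hexp

end OneLevel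

/-! ## §2. All levels: the (S1ᵀ) slot and Theorem 1 -/

section AllLevels

/-- **★★★ N11's (S1ᵀ) SLOT — THE THEOREM OF p. 245 IN LAW FORM, `∀ k < K, SLaw₁₃CoPH θ p k → TLaw₁₃CoPH θ p k` — FROM THE TWO PER-LEVEL DELIVERABLES**, generic `θ`
(§1 at each level; `1 ≤ M`, `0 ≤ B₀, E₀`).  Both deliverables DISPLAYED, not discharged. [cite: Balaban1988Convergent, Theorem p.245, Thm 1 p.262, §2 p.262, (3.24)–(3.25) p.270, p.279] -/
theorem thmP245Laws_of_tStep_of_supply (hM : 1 ≤ θ.τ9.M) (hB₀ : 0 ≤ θ.s2.lf.B₀) (hE₀ : 0 ≤ θ.s2.lf.E₀)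
    (hT : ∀ k, k < p.K → NoExpansionTStepAt θ p k) (hsup : ∀ k, k < p.K → Sect3SupplyAt θ p k) :
    ∀ k, k < p.K → SLaw₁₃CoPH F N θ p k → TLaw₁₃CoPH F N θ p k :=
  fun k hk hS => tLaw₁₃CoPH_of_sLaw₁₃CoPH_of_tStep_of_supply θ p hM hB₀ hE₀ hS (hT k hk) (hsup k hk)

/-- **★★★ THEOREM 1 OF [III] AT `θ`, ALL LEVELS, ALL HISTORIES — `∀ k ≤ K, SLaw₁₃CoPH θ p k` — ON THE LIVE-SELECTOR LINE**, by induction on `k` (`…LiveCoPH.sLaw₁₃CoPH_all_of_laws`):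
the start is def-T's `sLaw₁₃CoPH_zero` (`ρ₀` has no terms); the step is (S1ᵀ)_k (§2) followed by this seat's live-line 𝐑-step `…LiveCoPH.sLaw₁₃CoPH_succ_of_tLaw₁₃CoPH_of_liveSel_of_rstep`
(𝐑 of record integrates out only dead sequences; row `rstep` of `θ.Provisos₁₃CoPH`, admissibility, the selector clause, the signs `0 ≤ κ, E₀, B₀`).  MODULO EXACTLY the two per-level
deliverables. [cite: Balaban1988Convergent, Thm 1 p.262, Theorem p.245, p.244, §2 p.262, (3.24)–(3.25) p.270; Balaban1989LargeFieldI, (0.2)–(0.4) p.176, p.177 (i)–(ii)] -/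
theorem sLaw₁₃CoPH_all_of_tStep_of_supply_of_liveSel (h : θ.Provisos₁₃CoPH F N)
    (hsel : θ.ppSel = ppSelLiveOfRecord F N θ.ν θ.τ9 (EOfRecord₁₃ F N θ.toStage13Params) (wOfRecord₉ F N θ.toStage9Params))
    (hθ : θ.Admissible F N) (hκ : 0 ≤ θ.s2.lf.κ) (hE₀ : 0 ≤ θ.s2.lf.E₀) (hB₀ : 0 ≤ θ.s2.lf.B₀) (hM : 1 ≤ θ.τ9.M)
    (hT : ∀ k, k < p.K → NoExpansionTStepAt θ p k) (hsup : ∀ k, k < p.K → Sect3SupplyAt θ p k) :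
    ∀ k, k ≤ p.K → SLaw₁₃CoPH F N θ p k :=
  sLaw₁₃CoPH_all_of_laws F N θ p
    (fun k hk hTk => sLaw₁₃CoPH_succ_of_tLaw₁₃CoPH_of_liveSel_of_rstep F N θ p (fun q j _ hj => h.rstep q j hj) hθ hκ hE₀ hB₀ hsel k hk hTk)
    (thmP245Laws_of_tStep_of_supply θ p hM hB₀ hE₀ hT hsup)

end AllLevels

/-! ## §3. The node faces: [III]'s own slot name `B14.ThmP245PrintedI`, `densitiesDescribed` and `Dag.B14_main` at a world bound to the CoPH datum of `θ` -/

section Node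

/-- **★★★ THIS SEAT'S R134 ROW IN ITS HONEST FINAL FORM — [III]'s THEOREM OF p. 245, `B14.ThmP245PrintedI`, ALONG ANY FAMILY `T` OF RENORMALIZATION TRANSFORMATIONS AGREEING WITH
THE TOWER OF RECORD, AT THE STAGE-13 RECORD OF `θ`** (`ρ := densOfRecord₁₃`, the spaces `(VOfRecord₁₃CoPH θ p).S ∕ .Scorr`, `K := p.K`; the knit dictionary
`B14NodeKnitRecord13RCoPH.thmP245PrintedI_at_record₁₃CoPH_iff_laws` over §2) — MODULO EXACTLY the two per-level deliverables.  (The `RTOp` form `B14.ThmP245Printed` is the same Prop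
along `RTOp.toRTOpI`, `B14.thmP245PrintedI_toRTOpI_iff`.) [cite: Balaban1988Convergent, Theorem p.245, Thm 1 p.262, remark p.262, (3.25) p.270] -/
theorem thmP245PrintedI_of_tStep_of_supply (hM : 1 ≤ θ.τ9.M) (hB₀ : 0 ≤ θ.s2.lf.B₀) (hE₀ : 0 ≤ θ.s2.lf.E₀)
    (hT : ∀ k, k < p.K → NoExpansionTStepAt θ p k) (hsup : ∀ k, k < p.K → Sect3SupplyAt θ p k)
    (T : (k : ℕ) → RTOpI (F.P p.K) k (SU N) (avOfRecord F N p.K k))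
    (hTT : ∀ k, k < p.K → (T k).T (densOfRecord₁₃ F N θ.toStage13Params p k) = tdensOfRecord₁₃ F N θ.toStage13Params p k) :
    B14.ThmP245PrintedI T (densOfRecord₁₃ F N θ.toStage13Params p) (VOfRecord₁₃CoPH F N θ p).S (VOfRecord₁₃CoPH F N θ p).Scorr p.K :=
  (thmP245PrintedI_at_record₁₃CoPH_iff_laws F N θ p T hTT).2 (thmP245Laws_of_tStep_of_supply θ p hM hB₀ hE₀ hT hsup)

/-- **★★ N11's NODE SENTENCE `densitiesDescribed` AT A WORLD BOUND TO THE CoPH DATUM OF `θ`** (`w.C = (datumOfRecord₁₃CoPH θ h).C`) — Theorem 1 at all levels (§2) through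
`…LiveCoPH.densitiesDescribed_at_record₁₃CoPH_of_laws`.  MODULO EXACTLY the two per-level deliverables. [cite: Balaban1988Convergent, Thm 1 p.262, Theorem p.245, p.244; Balaban1989LargeFieldI, (0.3) p.176, p.177 (i)–(ii)] -/
theorem densitiesDescribed_of_tStep_of_supply_of_liveSel (h : θ.Provisos₁₃CoPH F N)
    (hsel : θ.ppSel = ppSelLiveOfRecord F N θ.ν θ.τ9 (EOfRecord₁₃ F N θ.toStage13Params) (wOfRecord₉ F N θ.toStage9Params))
    (hθ : θ.Admissible F N) (hκ : 0 ≤ θ.s2.lf.κ) (hE₀ : 0 ≤ θ.s2.lf.E₀) (hB₀ : 0 ≤ θ.s2.lf.B₀) (hM : 1 ≤ θ.τ9.M)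
    (hT : ∀ k, k < p.K → NoExpansionTStepAt θ p k) (hsup : ∀ k, k < p.K → Sect3SupplyAt θ p k)
    (w : WorldP) (hC : w.C = (datumOfRecord₁₃CoPH F N θ h).C) :
    (leavesP w p).densitiesDescribed :=
  densitiesDescribed_at_record₁₃CoPH_of_laws F N θ p w h hC
    (fun k hk hTk => sLaw₁₃CoPH_succ_of_tLaw₁₃CoPH_of_liveSel_of_rstep F N θ p (fun q j _ hj => h.rstep q j hj) hθ hκ hE₀ hB₀ hsel k hk hTk)
    (thmP245Laws_of_tStep_of_supply θ p hM hB₀ hE₀ hT hsup)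

/-- **★★ N11's DAG NODE `Dag.B14_main (leavesP w p)` AT A WORLD BOUND TO THE CoPH DATUM OF `θ`** — the 𝐑-antecedent read through the leaf at the carriers of record
(`…LiveCoPH.b14_main_at_record₁₃CoPH_of_rOpLeaf`; the leaf itself holds on the live line from row `rstep`, `rOpLeaf_VOfRecord₁₃CoPH_of_liveSel_of_rstep`), the (S1ᵀ) slot by §2 — so
the node's other in-edges `b7 … b11`, `smallCouplings`, `smallFieldInductive`, `flowControl` are not even read.  MODULO EXACTLY the two per-level deliverables.
[cite: Balaban1988Convergent, Thm 1 p.262, Theorem p.245, p.244; Balaban1989LargeFieldI, (0.3) p.176, p.177 (i)–(ii)] -/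
theorem b14_main_of_tStep_of_supply_of_liveSel (h : θ.Provisos₁₃CoPH F N)
    (hsel : θ.ppSel = ppSelLiveOfRecord F N θ.ν θ.τ9 (EOfRecord₁₃ F N θ.toStage13Params) (wOfRecord₉ F N θ.toStage9Params))
    (hθ : θ.Admissible F N) (hκ : 0 ≤ θ.s2.lf.κ) (hE₀ : 0 ≤ θ.s2.lf.E₀) (hB₀ : 0 ≤ θ.s2.lf.B₀) (hM : 1 ≤ θ.τ9.M)
    (hT : ∀ k, k < p.K → NoExpansionTStepAt θ p k) (hsup : ∀ k, k < p.K → Sect3SupplyAt θ p k)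
    (w : WorldP) (hC : w.C = (datumOfRecord₁₃CoPH F N θ h).C) :
    Dag.B14_main (leavesP w p) :=
  b14_main_at_record₁₃CoPH_of_rOpLeaf F N θ p w h hC
    (fun _ => rOpLeaf_VOfRecord₁₃CoPH_of_liveSel_of_rstep F N θ p (fun q j _ hj => h.rstep q j hj) hθ hκ hE₀ hB₀ hsel)
    (fun _ _ _ _ _ _ _ _ => thmP245Laws_of_tStep_of_supply θ p hM hB₀ hE₀ hT hsup)

/-- **★★ `B16.Thm1Printed (datumOfRecord₁₃CoPH F N θ h).C` — [III] THEOREM 1 AT THE CoPH DATUM OF `θ` (the route's (B)-face first conjunct; N13 ∕ N24-facing) FROM THE TWO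
PER-LEVEL DELIVERABLES ALONG EVERY WINDOWED RUN** (def-T's `thm1Printed_datumOfRecord₁₃CoPH_of_tLaw_rOpLeaf`: the (S1ᵀ) slot by §2 and the 𝐑-leaf on the live line,
`…LiveCoPH.rOpLeaf_VOfRecord₁₃CoPH_of_liveSel_of_rstep`).  MODULO EXACTLY the per-level deliverables on the runs whose flow stays in `]0, γ]`.
[cite: Balaban1988Convergent, Thm 1 p.262, Theorem p.245, p.244; Balaban1989LargeFieldII, Thm 1 p.355 (not exercised); Balaban1989LargeFieldI, (0.3) p.176, p.177 (i)–(ii)] -/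
theorem thm1Printed_datumOfRecord₁₃CoPH_of_tStep_of_supply_of_liveSel (h : θ.Provisos₁₃CoPH F N)
    (hsel : θ.ppSel = ppSelLiveOfRecord F N θ.ν θ.τ9 (EOfRecord₁₃ F N θ.toStage13Params) (wOfRecord₉ F N θ.toStage9Params))
    (hθ : θ.Admissible F N) (hκ : 0 ≤ θ.s2.lf.κ) (hE₀ : 0 ≤ θ.s2.lf.E₀) (hB₀ : 0 ≤ θ.s2.lf.B₀) (hM : 1 ≤ θ.τ9.M) {γ : ℝ} (hγ : 0 < γ)
    (hT : ∀ P : B12.RunParams, ((datumOfRecord₁₃CoPH F N θ h).C P).flow.InInterval γ P.K → ∀ k, k < P.K → NoExpansionTStepAt θ P k)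
    (hsup : ∀ P : B12.RunParams, ((datumOfRecord₁₃CoPH F N θ h).C P).flow.InInterval γ P.K → ∀ k, k < P.K → Sect3SupplyAt θ P k) :
    B16.Thm1Printed (datumOfRecord₁₃CoPH F N θ h).C :=
  thm1Printed_datumOfRecord₁₃CoPH_of_tLaw_rOpLeaf F N θ h hγ (fun P hP => thmP245Laws_of_tStep_of_supply θ P hM hB₀ hE₀ (hT P hP) (hsup P hP))
    (fun P _ => rOpLeaf_VOfRecord₁₃CoPH_of_liveSel_of_rstep F N θ P (fun q j _ hj => h.rstep q j hj) hθ hκ hE₀ hB₀ hsel)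

end Node

/-! ## §5. At the H-extensions of the WITNESS OF RECORD `theta13LiveOfRecord F N` (e.g. the re-pinned door of K0a's cured witness): the 𝐑-side is CLOSED there
(`…LiveCoPH.laws₁₃CoPH_theta13LiveOfRecord`), the selector clause, admissibility, `M = 1` and the signs are the family's numerals — ONLY the two deliverables remain -/

section Record

variable (F N)
variable (Zr : (q : B12.RunParams) → TkResidualW F N (FluctV N) q.K) (Zh : (q : B12.RunParams) → ℕ → (ℕ → Set (Site (F.P q.K) 0)) → (ℕ → Set (Site (F.P q.K) 0)) → TkResidualW F N (FluctV N) q.K)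
  (Phih : (q : B12.RunParams) → ℕ → (ℕ → Set (Site (F.P q.K) 0)) → (ℕ → Set (Site (F.P q.K) 0)) → (ℕ → Plaq (F.P q.K) 0 → ℝ)) (p : B12.RunParams)

/-- **★★★ THEOREM 1 OF [III] AT ANY H-EXTENSION `⟨⟨θ₁₃, Zr⟩, Zh, Phih⟩` OF THE WITNESS OF RECORD `θ₁₃ = theta13LiveOfRecord F N`, ALL LEVELS, ALL HISTORIES —
`∀ k ≤ K, SLaw₁₃CoPH … p k` — FROM THE TWO PER-LEVEL DELIVERABLES AND NOTHING ELSE**: the 𝐑-side `TLaw_k → SLaw_{k+1}` is this seat's CLOSED theorem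
`…LiveCoPH.laws₁₃CoPH_theta13LiveOfRecord` (K0b's residuals, K0a's live selector, admissibility and the signs of the family of record), `M = 1` and `0 ≤ E₀, B₀` are the family's
numerals.  In particular at the re-pinned door `rePinH (ofHistoryBlind (ofCured θ₁₃))` (such an extension by `rfl`), where dag-n11-d's face serves `NoExpansionTStepAt` (§4).
[cite: Balaban1988Convergent, Thm 1 p.262, Theorem p.245, p.244, (3.24)–(3.25) p.270, (1.11) p.248, (3.16)–(3.22) pp.268–269; Balaban1989LargeFieldI, (0.3)–(0.4) p.176, p.177 (i)–(ii)] -/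
theorem sLaw₁₃CoPH_all_theta13LiveOfRecordH_of_tStep_of_supply
    (hT : ∀ k, k < p.K → NoExpansionTStepAt (⟨⟨theta13LiveOfRecord F N, Zr⟩, Zh, Phih⟩ : Stage13HParams F N) p k)
    (hsup : ∀ k, k < p.K → Sect3SupplyAt (⟨⟨theta13LiveOfRecord F N, Zr⟩, Zh, Phih⟩ : Stage13HParams F N) p k) :
    ∀ k, k ≤ p.K → SLaw₁₃CoPH F N (⟨⟨theta13LiveOfRecord F N, Zr⟩, Zh, Phih⟩ : Stage13HParams F N) p k :=
  sLaw₁₃CoPH_all_of_laws F N _ p (laws₁₃CoPH_theta13LiveOfRecord F N Zr Zh Phih p)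
    (thmP245Laws_of_tStep_of_supply _ p (le_of_eq rfl)
      (B0_nonneg_theta13LiveOfFamily F N eps0OfRecord₁₃ (zeta316OfRecord F N (numerics7OfFamily eps0OfRecord₁₃) 1 1) (RzOfRecord F N) (ZtOfRecord F N))
      (E0_nonneg_theta13LiveOfFamily F N eps0OfRecord₁₃ (zeta316OfRecord F N (numerics7OfFamily eps0OfRecord₁₃) 1 1) (RzOfRecord F N) (ZtOfRecord F N)) hT hsup)

/-- **★★★ `B16.Thm1Printed` AT THE CoPH DATUM OF ANY H-EXTENSION OF THE WITNESS OF RECORD (`hrec : Provisos₁₃CoPH` is only the datum's key) FROM THE TWO PER-LEVEL DELIVERABLES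
ALONG THE WINDOWED RUNS — NOTHING ELSE** (the knit's `thm1Printed_datumOfRecord₁₃CoPH_theta13LiveOfRecord_of_thmP245I`, whose `ROpLeaf` is CLOSED, over §3's
`thmP245PrintedI_of_tStep_of_supply`; any `T`-family agreeing with the tower serves — the conclusion is `T`-free). [cite: Balaban1988Convergent, Theorem p.245, Thm 1 p.262, p.244; Balaban1989LargeFieldII, Thm 1 p.355; Balaban1989LargeFieldI, (0.3) p.176, p.177 (i)–(ii)] -/
theorem thm1Printed_datumOfRecord₁₃CoPH_theta13LiveOfRecordH_of_tStep_of_supply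
    (hrec : (⟨⟨theta13LiveOfRecord F N, Zr⟩, Zh, Phih⟩ : Stage13HParams F N).Provisos₁₃CoPH F N) {γ : ℝ} (hγ : 0 < γ)
    (T : (P : B12.RunParams) → (k : ℕ) → RTOpI (F.P P.K) k (SU N) (avOfRecord F N P.K k))
    (hTT : ∀ (P : B12.RunParams) (k : ℕ), k < P.K →
      (T P k).T (densOfRecord₁₃ F N (theta13LiveOfRecord F N) P k) = tdensOfRecord₁₃ F N (theta13LiveOfRecord F N) P k)
    (hT : ∀ P : B12.RunParams, ((datumOfRecord₁₃CoPH F N (⟨⟨theta13LiveOfRecord F N, Zr⟩, Zh, Phih⟩ : Stage13HParams F N) hrec).C P).flow.InInterval γ P.K →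
      ∀ k, k < P.K → NoExpansionTStepAt (⟨⟨theta13LiveOfRecord F N, Zr⟩, Zh, Phih⟩ : Stage13HParams F N) P k)
    (hsup : ∀ P : B12.RunParams, ((datumOfRecord₁₃CoPH F N (⟨⟨theta13LiveOfRecord F N, Zr⟩, Zh, Phih⟩ : Stage13HParams F N) hrec).C P).flow.InInterval γ P.K →
      ∀ k, k < P.K → Sect3SupplyAt (⟨⟨theta13LiveOfRecord F N, Zr⟩, Zh, Phih⟩ : Stage13HParams F N) P k) :
    B16.Thm1Printed (datumOfRecord₁₃CoPH F N (⟨⟨theta13LiveOfRecord F N, Zr⟩, Zh, Phih⟩ : Stage13HParams F N) hrec).C :=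
  thm1Printed_datumOfRecord₁₃CoPH_theta13LiveOfRecord_of_thmP245I F N Zr Zh Phih hrec hγ T hTT fun P hP =>
    thmP245PrintedI_of_tStep_of_supply _ P (le_of_eq rfl)
      (B0_nonneg_theta13LiveOfFamily F N eps0OfRecord₁₃ (zeta316OfRecord F N (numerics7OfFamily eps0OfRecord₁₃) 1 1) (RzOfRecord F N) (ZtOfRecord F N))
      (E0_nonneg_theta13LiveOfFamily F N eps0OfRecord₁₃ (zeta316OfRecord F N (numerics7OfFamily eps0OfRecord₁₃) 1 1) (RzOfRecord F N) (ZtOfRecord F N))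
      (hT P hP) (hsup P hP) (T P) (hTT P)

end Record

/-! ## §4. A6: where the two deliverables stand today -/

section A6

/-- **A6 — `Sect3SupplyAt θ p k` IS INHABITED AT A LEVEL WHERE NO SEQUENCE OF LENGTH `k+1` EXPANDS** (any `θ`, any run): for every exposed witness `(t, E_k)` the family
`s′ ↦ (truncAbove k (t (init s′)), E_k(init s′))` is universal in 𝐄 (because `t` is), keeps the old terms, has no level-`(k+1)` terms, and the expansion clause is void.  So the
predicate is consistent, and its entire content is [III] §3 at the sequences with `Ω_{k+1}(s′) ≠ ∅`. [cite: Balaban1988Convergent, §2 p.262, (3.25) p.270, (2.25)–(2.27) p.259 (bookkeeping)] -/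
theorem sect3SupplyAt_of_forall_Omega_empty (k : ℕ) (hno : ∀ s : SeqOfRecord F θ.ν θ.τ9.M (gOfRecord₁₃ F N θ.toStage13Params p) p.K (k + 1), s.Ω (k + 1) = ∅) :
    Sect3SupplyAt θ p k := by
  intro t Ek hS
  refine ⟨fun s => truncAbove k (t s.init), fun s => Ek s.init, universalE_truncAbove_comp hS.1 k _, fun s _ => ?_, fun s hs => absurd (hno s) hs⟩
  exact ⟨fun j hj X z g φ => truncAbove_E_of_le _ hj X z g φ, fun j hj X φ => truncAbove_R_of_le _ hj X φ, fun j hj X φ a => truncAbove_B_of_le _ hj X φ a,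
    fun X φ => truncAbove_R_of_lt _ (Nat.lt_succ_self k) X φ, fun X φ a => truncAbove_B_of_lt _ (Nat.lt_succ_self k) X φ a, rfl⟩

/-- **WHERE dag-n11-d's LANE STANDS TODAY, AS AN INSTANCE OF THE PREDICATE**: at the re-pinned parameter `rePinH θ` (core provisos of `θ`, `k < K`, `1 ≤ M`) their witness-first
face `…N11FluctTruncationGraph.exists_local_witness_clause_succ_rePinH_of_sLaw₁₃CoPH_of_graph` ((hA) ELIMINATED by fluctuation truncation, (hΦm ∕ hmB) ELIMINATED by the
averaging-graph measurability) delivers `NoExpansionTStepAt (rePinH θ) p k` GIVEN the ONE remaining old-branch row — `dU_k`-integrability `hIB` — for every `k`-LOCAL exposed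
witness at every no-expansion sequence (displayed; their door d3 «hIB specification» in flight; the row holds on the all-large diagonal, p563687).  One application, nothing restated.
[cite: Balaban1988Convergent, Theorem p.245, (3.24)–(3.25) p.270, (2.18) p.257, (2.23) p.258, (2.40)–(2.41) p.261] -/
theorem noExpansionTStepAt_rePinH_of_integrable_row (h : θ.Provisos₁₃CoPH F N) {k : ℕ} (hk : k < p.K) (hM : 1 ≤ θ.τ9.M)
    (hrow : ∀ (t : SeqOfRecord F θ.ν θ.τ9.M (gOfRecord₁₃ F N θ.toStage13Params p) p.K k → Sect2.TermValues (F.P p.K) (MatA N) (FluctV N) θ.τ9.M)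
      (Ek : SeqOfRecord F θ.ν θ.τ9.M (gOfRecord₁₃ F N θ.toStage13Params p) p.K k → ℝ),
      HasSect2FormAtZS F N (FluctV N) p.K (settingOfRecord₁₃ F N θ.toStage13Params p) k (θ.rzAt p) (WtOfRecord₁₃H F N (rePinH θ) p)
        (UbgOfRecord₁₃CoP F N θ.toStage13Params p k)
        (fun s u => Sect2.LawsRT (sect2TowerOfRecord F N (FluctV N) p.K (settingOfRecord₁₃ F N θ.toStage13Params p) (θ.rzAt p s) s u)
          (settingOfRecord₁₃ F N θ.toStage13Params p).lf k)
        (slotsOfRecord F N θ.ν θ.τ9 (EOfRecord₁₃ F N θ.toStage13Params) (wOfRecord₉ F N θ.toStage9Params) θ.ppSel p (gOfRecord₁₃ F N θ.toStage13Params p) k) t Ek →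
      (∀ s₀, IsFluctLocal k (t s₀)) →
      ∀ s : SeqOfRecord F θ.ν θ.τ9.M (gOfRecord₁₃ F N θ.toStage13Params p) p.K (k + 1), s.Ω (k + 1) = ∅ →
      ∀ S ∈ admSOfRecord F θ.ν θ.τ9.M (gOfRecord₁₃ F N θ.toStage13Params p) p.K k s.init,
      Integrable (fun U₀ : GaugeField (F.P p.K) k (SU N) =>
        tkBranchOfRecord F N (FluctV N) θ.ν θ.τ9.M _ p.K (WtOfRecord₁₃H F N (rePinH θ) p s) s.init S k
          (fun ω => sect2Operand F N (FluctV N) p.K (settingOfRecord₁₃ F N θ.toStage13Params p) (θ.rzAt p s.init) s.init (t s.init) (Ek s.init)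
            (UbgOfRecord₁₃CoP F N θ.toStage13Params p k s.init) (S, fun j => (ω j).2) (fun j => (ω j).1))
          (baseCfg (V := FluctV N) k U₀)) (fieldMeasure (F.P p.K) k (SU N))) :
    NoExpansionTStepAt (rePinH θ) p k := by
  intro hS
  obtain ⟨t, Ek, hform, hloc, hstep⟩ := exists_local_witness_clause_succ_rePinH_of_sLaw₁₃CoPH_of_graph θ p h hk hM hS
  exact ⟨t, Ek, hform, fun s hΩ => hstep s hΩ (hrow t Ek hform hloc s hΩ)⟩

end A6

/-! ## §6. At the re-pinned door of K0a's cured family ∕ of the witness of record: the no-expansion 𝐓-step AT LEVEL 0 is a THEOREM (a no-expansion history of length 1 IS the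
all-large-field one), hence `ρ₁`'s §2 form from [III] §3's level-0 supply ALONE -/

section DoorCured

variable (θ₀ : Stage13Params F N)

/-- **THE 𝐓-IMAGE CLAUSE ALONG THE ALL-LARGE-FIELD HISTORY AT THE RE-PINNED DOOR OF K0a's CURED FAMILY, FOR AN EXPOSED WITNESS** (dag-n11-d p569094 §2 with the witness
`(t₀, E₀)` displayed instead of hidden: their per-witness step `clause_succ_rePinH_of_Omega_empty_of_oldBranch_of_clause_of_integrable` with the three rows inhabited on the
diagonal — `hA_of_allLarge`, `measurable_sect2Operand_CoP_of_allLarge` + `hmB_rePinH_of_measurable_operand`, `integrable_tkBranch_door_of_allLarge` (the re-pinned door's weights at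
an all-large index ARE the door's, `WtOfRecord₁₃H_rePinH_door_seqAllLarge`)).  From `θ₀.Provisos₁₃Core`, `k < K`, `1 ≤ M` and the level-`k` clause for `(t₀, E₀)` at `init s`.
[cite: Balaban1988Convergent, Theorem p.245, Thm 1 p.262, (3.24)–(3.25) p.270, (2.20)–(2.23) p.258, (1.11) p.248] -/
theorem tClause_succ_rePinH_doorCured_of_allLarge_of_clause (h : θ₀.Provisos₁₃Core F N) {k : ℕ} (hk : k < p.K) (hM : 1 ≤ θ₀.τ9.M)
    (s : SeqOfRecord F θ₀.ν θ₀.τ9.M (gOfRecord₁₃ F N θ₀ p) p.K (k + 1)) (hall : ∀ j, 1 ≤ j → j ≤ k + 1 → s.Ω j = ∅)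
    (t₀ : Sect2.TermValues (F.P p.K) (MatA N) (FluctV N) θ₀.τ9.M) (E₀ : ℝ)
    (hid : slotsOfRecord F N θ₀.ν θ₀.τ9 (EOfRecord₁₃ F N θ₀) (wOfRecord₉ F N θ₀.toStage9Params) θ₀.ppSel p (gOfRecord₁₃ F N θ₀ p) k s.init = 0 ∨
      ∀ᵐ U₀ ∂fieldMeasure (F.P p.K) k (SU N),
        chiSeqOfRecord F N θ₀.ν θ₀.τ9.M (gOfRecord₁₃ F N θ₀ p) p.K k s.init U₀ ≠ 0 →
          slotsOfRecord F N θ₀.ν θ₀.τ9 (EOfRecord₁₃ F N θ₀) (wOfRecord₉ F N θ₀.toStage9Params) θ₀.ppSel p (gOfRecord₁₃ F N θ₀ p) k s.init U₀ =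
            sect2Slot F N (FluctV N) p.K (settingOfRecord₁₃ F N θ₀ p) (θ₀.Rz p.K)
              (WtOfRecord₁₃H F N (rePinH (Stage13HParams.ofHistoryBlind F N (Stage13RParams.ofCured F N θ₀))) p s.init) s.init t₀ E₀
              (UbgOfRecord₁₃CoP F N θ₀ p k s.init) U₀) :
    slotsTOfRecord F N θ₀.ν θ₀.τ9 (EOfRecord₁₃ F N θ₀) (wOfRecord₉ F N θ₀.toStage9Params) θ₀.ppSel p (gOfRecord₁₃ F N θ₀ p) (k + 1) s = 0 ∨
      ∀ᵐ V' ∂fieldMeasure (F.P p.K) (k + 1) (SU N),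
        chiSeqOfRecord F N θ₀.ν θ₀.τ9.M (gOfRecord₁₃ F N θ₀ p) p.K (k + 1) s V' ≠ 0 →
          slotsTOfRecord F N θ₀.ν θ₀.τ9 (EOfRecord₁₃ F N θ₀) (wOfRecord₉ F N θ₀.toStage9Params) θ₀.ppSel p (gOfRecord₁₃ F N θ₀ p) (k + 1) s V' =
            sect2Slot F N (FluctV N) p.K (settingOfRecord₁₃ F N θ₀ p) (θ₀.Rz p.K)
              (WtOfRecord₁₃H F N (rePinH (Stage13HParams.ofHistoryBlind F N (Stage13RParams.ofCured F N θ₀))) p s) s t₀ E₀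
              (UbgOfRecord₁₃CoP F N θ₀ p (k + 1) s) V' := by
  obtain rfl : s = seqAllLargeOfRecord F θ₀.ν θ₀.τ9.M (gOfRecord₁₃ F N θ₀ p) p.K (k + 1) :=
    BalabanUVNodesN11ResidualPinCompletion.seq_eq_seqAllLargeOfRecord θ₀.ν θ₀.τ9.M _ p.K (k + 1) s hall
  have hinit : (seqAllLargeOfRecord F θ₀.ν θ₀.τ9.M (gOfRecord₁₃ F N θ₀ p) p.K (k + 1)).init =
      seqAllLargeOfRecord F θ₀.ν θ₀.τ9.M (gOfRecord₁₃ F N θ₀ p) p.K k :=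
    BalabanUVNodesN11ResidualPinCompletion.seq_eq_seqAllLargeOfRecord θ₀.ν θ₀.τ9.M _ p.K k _ (init_allLarge θ₀ p _ hall)
  have hW := WtOfRecord₁₃H_rePinH_door_seqAllLarge p (Stage13RParams.ofCured F N θ₀) rfl (k + 1)
  refine clause_succ_rePinH_of_Omega_empty_of_oldBranch_of_clause_of_integrable (Stage13HParams.ofHistoryBlind F N (Stage13RParams.ofCured F N θ₀)) p
    h.ofCured.ofHistoryBlind hk hM _ rfl t₀ E₀ (hA_of_allLarge θ₀ p hM _ hall _ _ t₀ E₀) hid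
    (fun S _ => hmB_rePinH_of_measurable_operand (Stage13HParams.ofHistoryBlind F N (Stage13RParams.ofCured F N θ₀)) p h.ofCured.ofHistoryBlind _ S
      (measurable_sect2Operand_CoP_of_allLarge θ₀ p hM _ (init_allLarge θ₀ p _ hall) _ t₀ E₀ S)) (fun S hSm => ?_)
  have hS0 : S = fun _ => ∅ := by
    have this : S ∈ admSOfRecord F θ₀.ν θ₀.τ9.M (gOfRecord₁₃ F N θ₀ p) p.K k
        (seqAllLargeOfRecord F θ₀.ν θ₀.τ9.M (gOfRecord₁₃ F N θ₀ p) p.K (k + 1)).init := hSm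
    rw [admSOfRecord_init_eq_of_allLarge θ₀ p _ hall, Finset.mem_singleton] at this
    exact this
  subst hS0
  have hI := integrable_tkBranch_door_of_allLarge θ₀ p h hM (le_of_lt hk)
    ((Stage13HParams.ofHistoryBlind F N (Stage13RParams.ofCured F N θ₀)).rzAt p
      (seqAllLargeOfRecord F θ₀.ν θ₀.τ9.M (gOfRecord₁₃ F N θ₀ p) p.K (k + 1)).init) t₀ E₀ k le_rfl
  rw [← hinit] at hI
  have hW' : WtOfRecord₁₃H F N (rePinH (Stage13HParams.ofHistoryBlind F N (Stage13RParams.ofCured F N θ₀))) p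
      (seqAllLargeOfRecord F θ₀.ν θ₀.τ9.M (gOfRecord₁₃ F N θ₀ p) p.K (k + 1)) = WtOfRecord₁₃R F N (Stage13RParams.ofCured F N θ₀) p := hW
  rw [hW']
  exact hI

/-- **★★ THE NO-EXPANSION 𝐓-STEP AT LEVEL 0 IS A THEOREM AT THE RE-PINNED DOOR OF K0a's CURED FAMILY**: a history of length `1` with `Ω₁ = ∅` IS the all-large-field one, where all
three rows of dag-n11-d's step are inhabited (§6's first theorem) — so `NoExpansionTStepAt (rePinH (ofHistoryBlind (ofCured θ₀))) p 0` from `θ₀.Provisos₁₃Core`, `0 < K`,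
`1 ≤ M`, with ANY exposed witness of `ρ₀`'s §2 form. [cite: Balaban1988Convergent, Theorem p.245, Thm 1 p.262, (3.24)–(3.25) p.270, (2.21) p.258, (1.11) p.248] -/
theorem noExpansionTStepAt_rePinH_doorCured_zero (h : θ₀.Provisos₁₃Core F N) (hK : 0 < p.K) (hM : 1 ≤ θ₀.τ9.M) :
    NoExpansionTStepAt (rePinH (Stage13HParams.ofHistoryBlind F N (Stage13RParams.ofCured F N θ₀))) p 0 := by
  intro hS
  obtain ⟨t, Ek, hS'⟩ := (sLaw₁₃CoPH_iff F N (rePinH (Stage13HParams.ofHistoryBlind F N (Stage13RParams.ofCured F N θ₀))) p 0).1 hS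
  exact ⟨t, Ek, hS', fun s hΩ => tClause_succ_rePinH_doorCured_of_allLarge_of_clause p θ₀ h hK hM s
    (fun j h1 hj => by obtain rfl : j = 1 := le_antisymm hj h1; exact hΩ) (t s.init) (Ek s.init) (hS'.2 s.init).2⟩

/-- **★★ … HENCE `ρ₁`'s §2 FORM AT THE RE-PINNED DOOR OF K0a's CURED FAMILY FROM [III] §3's LEVEL-0 SUPPLY ALONE** (on the live-selector line of `θ₀`, admissibility and the
signs): `SLaw₁₃CoPH … p 1` for EVERY history of length 1 — the no-expansion one by §6, the expansion ones (`Ω₁ ≠ ∅`: [I] Thm 1 + [II], the first small-field step) by the supply.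
[cite: Balaban1988Convergent, Thm 1 p.262, Theorem p.245, p.244, (3.24)–(3.25) p.270; Balaban1989LargeFieldI, (0.3)–(0.4) p.176, p.177 (i)–(ii)] -/
theorem sLaw₁₃CoPH_one_rePinH_doorCured_of_sect3Supply_zero_of_liveSel (h : θ₀.Provisos₁₃Core F N)
    (hsel : θ₀.ppSel = ppSelLiveOfRecord F N θ₀.ν θ₀.τ9 (EOfRecord₁₃ F N θ₀) (wOfRecord₉ F N θ₀.toStage9Params))
    (hθ : θ₀.Admissible F N) (hκ : 0 ≤ θ₀.s2.lf.κ) (hE₀ : 0 ≤ θ₀.s2.lf.E₀) (hB₀ : 0 ≤ θ₀.s2.lf.B₀) (hK : 0 < p.K) (hM : 1 ≤ θ₀.τ9.M)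
    (hsup : Sect3SupplyAt (rePinH (Stage13HParams.ofHistoryBlind F N (Stage13RParams.ofCured F N θ₀))) p 0) :
    SLaw₁₃CoPH F N (rePinH (Stage13HParams.ofHistoryBlind F N (Stage13RParams.ofCured F N θ₀))) p 1 :=
  sLaw₁₃CoPH_succ_of_tLaw₁₃CoPH_of_liveSel_of_rstep F N (rePinH (Stage13HParams.ofHistoryBlind F N (Stage13RParams.ofCured F N θ₀))) p
    (fun q j _ hj => (provisos₁₃CoPH_rePinH h.ofCured.ofHistoryBlind).rstep q j hj) hθ hκ hE₀ hB₀ hsel 0 hK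
    (tLaw₁₃CoPH_of_sLaw₁₃CoPH_of_tStep_of_supply _ p hM hB₀ hE₀ (sLaw₁₃CoPH_zero F N _ p) (noExpansionTStepAt_rePinH_doorCured_zero p θ₀ h hK hM) hsup)

end DoorCured

section DoorRecord

variable (F N)

/-- **★★★ AT THE RE-PINNED DOOR OF THE CURED WITNESS OF RECORD — HYPOTHESIS-FREE BUT FOR `0 < K`: the no-expansion 𝐓-step at level 0** (`Node00.provisos₁₃Core_theta13LiveOfRecord`,
`M = 1`). [cite: Balaban1988Convergent, Theorem p.245, Thm 1 p.262, (3.24)–(3.25) p.270, (1.11) p.248] -/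
theorem noExpansionTStepAt_rePinH_doorCured_theta13LiveOfRecord_zero (hK : 0 < p.K) :
    NoExpansionTStepAt (rePinH (Stage13HParams.ofHistoryBlind F N (Stage13RParams.ofCured F N (theta13LiveOfRecord F N)))) p 0 :=
  noExpansionTStepAt_rePinH_doorCured_zero p (theta13LiveOfRecord F N) (provisos₁₃Core_theta13LiveOfRecord F N) hK (le_of_eq rfl)

/-- **★★★ `ρ₁`'s §2 FORM AT THE RE-PINNED DOOR OF THE CURED WITNESS OF RECORD, EVERY HISTORY OF LENGTH 1, FROM [III] §3's LEVEL-0 SUPPLY AND NOTHING ELSE** (`0 < K`; the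
𝐑-side, the selector, admissibility, `M = 1` and the signs are the record's — `laws₁₃CoPH_theta13LiveOfRecord`, `provisos₁₃Core_theta13LiveOfRecord`, the family's numerals).
[cite: Balaban1988Convergent, Thm 1 p.262, Theorem p.245, p.244, (3.24)–(3.25) p.270; Balaban1989LargeFieldI, (0.3)–(0.4) p.176, p.177 (i)–(ii)] -/
theorem sLaw₁₃CoPH_one_rePinH_doorCured_theta13LiveOfRecord_of_sect3Supply_zero (hK : 0 < p.K)
    (hsup : Sect3SupplyAt (rePinH (Stage13HParams.ofHistoryBlind F N (Stage13RParams.ofCured F N (theta13LiveOfRecord F N)))) p 0) :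
    SLaw₁₃CoPH F N (rePinH (Stage13HParams.ofHistoryBlind F N (Stage13RParams.ofCured F N (theta13LiveOfRecord F N)))) p 1 :=
  laws₁₃CoPH_theta13LiveOfRecord F N _ _ _ p 0 hK
    (tLaw₁₃CoPH_of_sLaw₁₃CoPH_of_tStep_of_supply _ p (le_of_eq rfl)
      (B0_nonneg_theta13LiveOfFamily F N eps0OfRecord₁₃ (zeta316OfRecord F N (numerics7OfFamily eps0OfRecord₁₃) 1 1) (RzOfRecord F N) (ZtOfRecord F N))
      (E0_nonneg_theta13LiveOfFamily F N eps0OfRecord₁₃ (zeta316OfRecord F N (numerics7OfFamily eps0OfRecord₁₃) 1 1) (RzOfRecord F N) (ZtOfRecord F N))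
      (sLaw₁₃CoPH_zero F N _ p) (noExpansionTStepAt_rePinH_doorCured_theta13LiveOfRecord_zero F N p hK) hsup)

end DoorRecord

end Summit.QuantumFields.YangMills.Theorems.BalabanUVNodesN11ThmP245OfSect3SupplyCoPH

end
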